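import Literature.MathematicalPhysics.QuantumFieldTheory.Balaban1983to89.B9Thm31SiteGsqGradDecayReg335Y
import Literature.MathematicalPhysics.QuantumFieldTheory.Balaban1983to89.B9Thm37CutoffGradTerms

/-!
# `Balaban1983to89.B9Thm31SiteGsqCutoffMixedReg335Y` — T. Bałaban, *Propagators for lattice gauge theories in a background field*, Commun. Math. Phys.
# **99** (1985) 389–434 [Balaban1985BackgroundPropagators] Cor 3.6 p. 408 ∕ (3.46) p. 398 ∕ (3.87)–(3.89) p. 409, with [4] = [Balaban1984PropagatorsII] (2.39)–(2.44)
# pp. 229–230, p. 247: ★★★ **(3.46c) `G′_□∇*_U` FOR THE GENUINE LOCAL CUBE INVERSES (by duality, and in the forward weight orientation) AND THE CUT-OFF–SANDWICHED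
# MIXED MEMBER `∇_{U,ν} M_h G′_□(U) M_h ∇*_{U,μ}` IN `L²`, UNIFORMLY IN □** — the 𝔸-level shape of the walk's `L2MixedLegs37.lm` and of the field its `K(h_□)`-factors
# read (file 22 of the site-sector set of width seat `pub-ymgap-dag-n06-w1`; files 19–21 = `B9Thm31SiteGsq{Bounds, Decay, GradDecay}Reg335Y`)

statement-level skeleton of published theorems with citation tags; proofs where landed; nothing here is a claim about the Yang–Mills mass gap

THE PRINT (verbatim).  p. 408, Cor 3.6: *«the operators `G′_□`, `G_□` … satisfy the inequalities (3.42)–(3.47) with constants independent of □»*; p. 409, (3.87)–(3.89):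
*«G′₀ = Σ_{□⊂T′_η} h_□ G′_□ h_□ … |(K(h_□)G′_□h_□λ)(x)| ≤ O(M⁻¹)e^{−δ₀(Lʲη)⁻¹|y−y′|}|λ|»*; [4] p. 247: *«|∂h_□| ≤ O(1)(MLʲη)⁻¹»*; (3.46) p. 398 (the six `L²` members).

WHY THIS FILE (cell `pub-ymgap`, node N06 [B9], width seat `pub-ymgap-dag-n06-w1`, gen 3).  Row 18 of the N06 certificate displays, for the terms of the walk (3.90), the
MIXED `L²` member of the cut-off–sandwiched cube operators `∇_ν∘(M_{h_□}G′_□(U)M_{h_□})∘∇*_μ` (dag-n06-k's `L2MixedLegs37.lm`) and the `K(h_□)`-factor readings of the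
same field (`FactorsL2Mixed37`), at cube operators which the walk-letter instance W-a pins to def-Y's `GsqY` and cut-offs `hTY c`.  THIS FILE gives them at the 𝔸
level in the trace-`L²` currency of files 6–21, for an ARBITRARY site set `D` and an ARBITRARY real cut-off `h` with `|h| ≤ 1` and one-step oscillation `≤ κ` (for
`h_□ = hTY c`: `κ = C1F∕(8∕5·S_j)`, lit-balaban `B9Thm37CubeCoverCommutatorSizes.abs_hTY_shiftY_sub_le`), in ONE weight orientation (`ω = 1` on the source set
`B ⊇ supp λ ∪ (supp λ + e_μ)`, `ω ≥ W` on `A`): `M_h∇*_μλ = ∇*_μ(M_hλ) + r`, `‖r‖ ≤ κ‖λ‖` ([4] (2.39)–(2.40)); (3.46e) and a FORWARD (3.46c) on `G′_□∇*_μ(M_hλ)`,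
(3.46b) and (3.46a) on `G′_□r`; Leibniz through the outer `∇_νM_h`.  Net `O(1)∕W²` once `κ·L^j = O(M⁻¹)`: print's constant `1` for the mixed member, decay `W = e^{δ₀r}`.

WHAT IS PROVED (sorry-free; 0 `def`).  `G ≤ U(N)`; on the class `(bg9K (M_N ℂ) G i).Reg335 c α₀`, `N ≥ 1`, `0 ≤ c·M·α₀`, `c·M·α₀·(d+1) ≤ 1∕16` where stated.
* §G2 (3.46c) by duality (files 9∕19): `trIP_cdS_GsqY_adjoint`, ★★ `hs_restrict_GsqY_cdsS_le` (weight `= 1` on the OUTPUT set; the canonical-weight reading is as in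
  file 9, via file 7's `bondRatio_exp_le ∕ blockOsc_exp_le`).
* §C1 cut-off calculus (regime-free; Leibniz through `∇_ν` is lit-balaban's `B9Thm37CutoffGradTerms.cdS_cutMulY_eq`): `hs_cdS_cutMulY_le`, `cutMulY_cdsS_sub_apply`
  (`[M_h, ∇*_μ]`), `hs_cutMulY_cdsS_sub_le`, `trIP_cutMulY_cdsS_sub_le` (`‖M_h∇*λ − ∇*(M_hλ)‖² ≤ κ²‖λ‖²`), `trIP_cutMulY_self_le`.
* §C2 ★★ `hs_restrict_GsqY_cdsS_le_fwd` — (3.46c) with the weight `= 1` on the SOURCE set: `Σ_{z∈A}HS((G′_□∇*_μλ′)(z)) ≤ 16(L^{j_A})²∕W²·‖λ′‖²₁`.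
* §C3 ★★ `hs_restrict_GsqY_cutMulY_cdsS_le` (`Φ := G′_□M_h∇*_μλ` on `A`: `≤ 2(16 + 256κ²L^{2j_B})L^{2j_A}∕W²·‖λ‖²`), ★★ `hs_restrict_cdS_GsqY_cutMulY_cdsS_le` (`Σ_νHS(∇_νΦ)`
  on `A`: `≤ 2(10 + 160κ²L^{2j_B})∕W²·‖λ‖²`), ★★★ `hs_restrict_cdS_cutMulY_GsqY_cutMulY_cdsS_le` (`Σ_{z∈A}HS((∇_νM_hG′_□M_h∇*_μλ)(z)) ≤
  4(10 + κ²(16L^{2j_A} + 160L^{2j_B}) + 256κ⁴L^{2j_A}L^{2j_B})∕W²·‖λ‖²`).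
MODEL ∕ SCOPE.  As files 19–21 (def-Y's letters, fibre `M_N(ℂ)`, weight-`1` trace pairing, lattice units, □̃ = arbitrary `D`, `GsqY` and `cutMulY` BY NAME).  NOT HERE:
the instantiation `h = hTY c`, `D = cubeDomY x c` and the block-`L²`∕coordinate reading (dag-n06-d FILE C); the second-order member `M_hG′_□M_h∇*∇*`; the sup-norm
(3.42).  NON-VACUITY (A6): `U ≡ 1 ∈ Reg335`, canonical weight, `h ≡ 1` with `κ = 0`.  HONEST SCOPE: energy∕Agmon bookkeeping over landed estimates; NOT a node
discharge, NOT summit progress; count-neutral; nothing continuum ∕ OS ∕ mass gap ∕ Clay.  NEW file importing file 21 and `B9Thm37CutoffGradTerms` only.  Net new unproved facts: 0.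
-/


noncomputable section

namespace Literature.MathematicalPhysics.QuantumFieldTheory.Balaban1983to89.B9Thm31SiteGsqCutoffMixedReg335Y

open Literature.MathematicalPhysics.QuantumFieldTheory.Balaban1983to89
open Node00 B6KLevelCensusIndexV1 B6Geom246MultiLevelBox B6MultiLevelBoxOperator B6MultiLevelTorusOperator B6GlobalChartV1 B9BackgroundsKLevelV1
  B9Eq39Adjoint B9Thm311ReadingCoords B9Thm311DeltaPrimePos B9Ineq369CurvatureSmallAtLettersY B9Thm31SiteCoerciveGaugeBlockY B9Thm31SiteCoerciveReg335Y
  B9Thm31SiteGpBoundsReg335Y B9Thm31SitePolarisedFormY B9Thm31SiteConjugatedFormY B9Thm31SiteGpDecayReg335Y B9Thm31SiteAgmonWeightY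
  B9Thm31SiteGpGradDecayReg335Y B9Thm31SiteGpDivDecayReg335Y B9Thm31SiteGradGpDivDecayReg335Y Node00.OpsYLocalInverse B9Thm311LocalInversePosY
  B9Thm31SiteGsqBoundsReg335Y B9Thm31SiteGsqDecayReg335Y B9Thm31SiteGsqGradDecayReg335Y B9Thm37CutoffGradTerms
open Literature.MathematicalPhysics.QuantumFieldTheory.Balaban1983to89.B9Ineq349SiteAdjoint (trIP_comm trIP_cdS_left)
open Literature.MathematicalPhysics.QuantumFieldTheory.Balaban1983to89.B9Thm311FlippedBondLetters (hs_real_smul)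
open Literature.MathematicalPhysics.QuantumFieldTheory.Balaban1983to89.B9Thm37CubeCoverCommutators (cutMulY cutMulY_apply)
open scoped Matrix Matrix.Norms.L2Operator

variable {d ℓ : ℕ} {hd : 1 ≤ d + 1} {hL : Odd (ℓ + 1) ∧ 1 < ℓ + 1} {b₀ b₁ : ℝ}
variable (i : KIdx d ℓ hd hL b₀ b₁) {N : ℕ} {G : Subgroup (Matrix (Fin N) (Fin N) ℂ)ˣ}

/-! ## §G2 (3.46c) for `G′_□(U)` by duality -/

/-- `∇_{U,μ}∘G′_□(U)` and `G′_□(U)∘∇\*_{U,μ}` ARE ADJOINT for the trace pairing at a `G`-valued background, `G ≤ U(N)`: `⟨∇_{U,μ}G′Ψ, λ⟩₁ = ⟨Ψ, G′∇\*_{U,μ}λ⟩₁`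
(dag-n06-i's `trIP_cdS_left` and `isSymmTr_GpY_parSymY`). [cite: Balaban1985BackgroundPropagators, (3.8) p.392, (3.25) p.394] -/
theorem trIP_cdS_GsqY_adjoint (hG : G ≤ B7Prop2Explicit.unitaryUnits (Matrix (Fin N) (Fin N) ℂ)) {U : CfgY (Matrix (Fin N) (Fin N) ℂ) i}
    (hU : ∀ μ x, U μ x ∈ G) (D : Finset (SiteY i)) (μ : Fin (d + 1)) (Ψ Λ : SiteY i → Matrix (Fin N) (Fin N) ℂ) :
    trIP (fun _ => (1 : ℝ)) (cdS i U μ (GsqY i (parSymY i) D U Ψ)) Λ = trIP (fun _ => (1 : ℝ)) Ψ (GsqY i (parSymY i) D U (cdsS i U μ Λ)) := by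
  rw [trIP_cdS_left i (fun μ x => hG (hU μ x)) μ, isSymmTr_GsqY_parSymY i hG hU D]

/-- ★★★ **THE `L²`-LOCAL DECAY OF `G′_□(U)∇\*_U` ON THE CLASS (3.35) — (3.46c)'s SHAPE, BY DUALITY FROM §G1.**  Hypotheses of §G1's
`hs_restrict_cdS_GsqY_parSymY_le` (class; weight `ω` with `ω = 1` on `B`, `ω ≥ W > 0` on `A`, bond ratios, block oscillation, `(d+1)θ_b + θ_s∕2 ≤ 1∕16`,
`0 ≤ θ_b, θ_s`, levels `≤ j_B` on `B`).  THEN for every direction `μ` and every `λ` vanishing off `A`: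
`Σ_{z∈B} HS((G′_□(U)∇\*_{U,μ}λ)(z)) ≤ 160·((L^{j_B})²∕W²)·‖λ‖²₁`. [cite: Balaban1985BackgroundPropagators, Cor 3.6 p.408, Thm 3.1 (3.46) p.398, (3.79) p.406, (3.8) p.392; Agmon1982, Ch.1, Thm 1.5] -/
theorem hs_restrict_GsqY_cdsS_le [Nonempty (Fin N)] (hG : G ≤ B7Prop2Explicit.unitaryUnits (Matrix (Fin N) (Fin N) ℂ))
    {U : CfgY (Matrix (Fin N) (Fin N) ℂ) i} {c α₀ : ℝ} (hC0 : 0 ≤ c * (kGeo i).M * α₀) (hC1 : c * (kGeo i).M * α₀ * ((d : ℝ) + 1) ≤ 1 / 16)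
    (hreg : (bg9K (Matrix (Fin N) (Fin N) ℂ) G i).Reg335 c α₀ U) (D : Finset (SiteY i)) {ω : SiteY i → ℝ} (hω : ∀ z, 0 < ω z) {θb θs : ℝ} (hθb0 : 0 ≤ θb) (hθs0 : 0 ≤ θs)
    (hb1 : ∀ μ z, ω (shiftY i μ z) / ω z + ω z / ω (shiftY i μ z) - 2 ≤ θb * (((((ℓ + 1) ^ (blkOf i.D.toDomains z).1.1 : ℕ) : ℝ)) ^ 2)⁻¹)
    (hb2 : ∀ μ z, ω (shiftY i μ z) / ω z + ω z / ω (shiftY i μ z) - 2 ≤ θb * (((((ℓ + 1) ^ (blkOf i.D.toDomains (shiftY i μ z)).1.1 : ℕ) : ℝ)) ^ 2)⁻¹)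
    (hs : ∀ z w : SiteY i, blkOf i.D.toDomains w = blkOf i.D.toDomains z → ω z / ω w + ω w / ω z - 2 ≤ θs)
    (hκ : ((d : ℝ) + 1) * θb + θs / 2 ≤ 1 / 16)
    {A B : Finset (SiteY i)} (hωB : ∀ z ∈ B, ω z = 1) {jB : ℕ} (hjB : ∀ z ∈ B, (blkOf i.D.toDomains z).1.1 ≤ jB) {W : ℝ} (hW0 : 0 < W)
    (hW : ∀ z ∈ A, W ≤ ω z) (μ : Fin (d + 1)) (Λ : SiteY i → Matrix (Fin N) (Fin N) ℂ) (hΛ : ∀ z, z ∉ A → Λ z = 0) :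
    ∑ z ∈ B, ∑ a, ∑ b, ‖GsqY i (parSymY i) D U (cdsS i U μ Λ) z a b‖ ^ 2
      ≤ 160 * (((((ℓ + 1) ^ jB : ℕ) : ℝ)) ^ 2 / W ^ 2) * trIP (fun _ => (1 : ℝ)) Λ Λ := by
  classical
  have hU : ∀ μ x, U μ x ∈ G := hreg.1
  refine hs_restrict_dual_le (T := fun Ψ => cdS i U μ (GsqY i (parSymY i) D U Ψ)) (T' := fun Λ => GsqY i (parSymY i) D U (cdsS i U μ Λ))
    (fun Ψ Λ => trIP_cdS_GsqY_adjoint i hG hU D μ Ψ Λ) (by positivity) (fun Ψ hΨ => ?_) Λ hΛ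
  refine le_trans ?_ (hs_restrict_cdS_GsqY_parSymY_le i hG hC0 hC1 hreg D hω hθb0 hθs0 hb1 hb2 hs hκ hΨ hωB hjB hW0 hW)
  exact Finset.sum_le_sum fun z _ => Finset.single_le_sum (f := fun ν : Fin (d + 1) => ∑ a, ∑ b, ‖cdS i U ν (GsqY i (parSymY i) D U Ψ) z a b‖ ^ 2)
    (fun ν _ => hs_nonneg _) (Finset.mem_univ μ)

section CutoffMixed

/-! ## §C1 A real cut-off through one covariant derivative (Leibniz) and past `∇*` (commutator) -/

/-- the `HS` size of the Leibniz rule `∇_{U,ν}(hΦ)(z) = h(z+e_ν)(∇_{U,ν}Φ)(z) + (h(z+e_ν) − h(z))Φ(z)` (lit-balaban `B9Thm37CutoffGradTerms.cdS_cutMulY_eq`)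
when `|h| ≤ 1` and `|h(z+e_ν) − h(z)| ≤ κ`: `HS(∇_{U,ν}(hΦ)(z)) ≤ 2·HS((∇_{U,ν}Φ)(z)) + 2κ²·HS(Φ z)`.
[cite: Balaban1984PropagatorsII, p.247 («|∂h_□| ≤ O(1)(MLʲη)⁻¹»); Balaban1985BackgroundPropagators, (3.88)–(3.89) p.409] -/
theorem hs_cdS_cutMulY_le (U : CfgY (Matrix (Fin N) (Fin N) ℂ) i) (ν : Fin (d + 1)) {h : SiteY i → ℝ} {κ : ℝ} (hh1 : ∀ z, |h z| ≤ 1)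
    (hhκ : ∀ μ z, |h (shiftY i μ z) - h z| ≤ κ) (Φ : SiteY i → Matrix (Fin N) (Fin N) ℂ) (z : SiteY i) :
    ∑ a, ∑ b, ‖cdS i U ν (cutMulY h Φ) z a b‖ ^ 2 ≤ 2 * ∑ a, ∑ b, ‖cdS i U ν Φ z a b‖ ^ 2 + 2 * κ ^ 2 * ∑ a, ∑ b, ‖Φ z a b‖ ^ 2 := by
  rw [cdS_cutMulY_eq]
  have h1 := hs_add_le (((h (shiftY i ν z) : ℝ) : ℂ) • cdS i U ν Φ z) ((((h (shiftY i ν z) - h z : ℝ)) : ℂ) • Φ z)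
  rw [hs_real_smul, hs_real_smul] at h1
  have hA := hs_nonneg (cdS i U ν Φ z)
  have hB := hs_nonneg (Φ z)
  have hκ0 : 0 ≤ κ := le_trans (abs_nonneg _) (hhκ ν z)
  have hh2 : h (shiftY i ν z) ^ 2 ≤ 1 := by
    have := hh1 (shiftY i ν z); rw [← sq_abs]; nlinarith [abs_nonneg (h (shiftY i ν z))]
  have hd2 : (h (shiftY i ν z) - h z) ^ 2 ≤ κ ^ 2 := by
    rw [← sq_abs]; exact pow_le_pow_left₀ (abs_nonneg _) (hhκ ν z) 2
  nlinarith [mul_le_mul_of_nonneg_right hh2 hA, mul_le_mul_of_nonneg_right hd2 hB]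

/-- **THE COMMUTATOR OF A REAL CUT-OFF WITH `∇*_{U,μ}`**: `h·(∇*_{U,μ}λ)(z) − (∇*_{U,μ}(hλ))(z) = (h(z) − h(z−e_μ))·R(U_μ(z−e_μ))⁻¹λ(z−e_μ)`.
[cite: Balaban1984PropagatorsII, (2.39)–(2.40) pp.229–230; Balaban1985BackgroundPropagators, (3.88) p.409] -/
theorem cutMulY_cdsS_sub_apply (U : CfgY (Matrix (Fin N) (Fin N) ℂ) i) (μ : Fin (d + 1)) (h : SiteY i → ℝ) (Λ : SiteY i → Matrix (Fin N) (Fin N) ℂ)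
    (z : SiteY i) :
    cutMulY h (cdsS i U μ Λ) z - cdsS i U μ (cutMulY h Λ) z
      = (((h z - h ((shiftY i μ).symm z) : ℝ)) : ℂ) • R (UboxY i U μ ((shiftY i μ).symm z))⁻¹ (Λ ((shiftY i μ).symm z)) := by
  rw [cutMulY_apply]
  show ((h z : ℝ) : ℂ) • (R (UboxY i U μ ((shiftY i μ).symm z))⁻¹ (Λ ((shiftY i μ).symm z)) - Λ z)
      - (R (UboxY i U μ ((shiftY i μ).symm z))⁻¹ (cutMulY h Λ ((shiftY i μ).symm z)) - cutMulY h Λ z) = _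
  rw [cutMulY_apply, cutMulY_apply, R_smul, Complex.ofReal_sub, sub_smul, smul_sub]
  abel

/-- its `HS` size: `HS(h·∇*_{U,μ}λ − ∇*_{U,μ}(hλ))(z) ≤ κ²·HS(λ(z−e_μ))` (`G`-valued `U`, `G ≤ U(N)`).
[cite: Balaban1984PropagatorsII, p.247; Balaban1985BackgroundPropagators, (3.89) p.409] -/
theorem hs_cutMulY_cdsS_sub_le (hG : G ≤ B7Prop2Explicit.unitaryUnits (Matrix (Fin N) (Fin N) ℂ)) {U : CfgY (Matrix (Fin N) (Fin N) ℂ) i}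
    (hU : ∀ μ x, U μ x ∈ G) (μ : Fin (d + 1)) {h : SiteY i → ℝ} {κ : ℝ} (hhκ : ∀ μ z, |h (shiftY i μ z) - h z| ≤ κ)
    (Λ : SiteY i → Matrix (Fin N) (Fin N) ℂ) (z : SiteY i) :
    ∑ a, ∑ b, ‖(cutMulY h (cdsS i U μ Λ) z - cdsS i U μ (cutMulY h Λ) z) a b‖ ^ 2 ≤ κ ^ 2 * ∑ a, ∑ b, ‖Λ ((shiftY i μ).symm z) a b‖ ^ 2 := by
  rw [cutMulY_cdsS_sub_apply, hs_real_smul]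
  have hV := contractive_of_mem_unitary (V := UboxY i U μ ((shiftY i μ).symm z)) (hG (hU μ _))
  have hVi : ‖(((UboxY i U μ ((shiftY i μ).symm z))⁻¹ : (Matrix (Fin N) (Fin N) ℂ)ˣ) : Matrix (Fin N) (Fin N) ℂ)‖ ≤ 1 ∧
      ‖((((UboxY i U μ ((shiftY i μ).symm z))⁻¹)⁻¹ : (Matrix (Fin N) (Fin N) ℂ)ˣ) : Matrix (Fin N) (Fin N) ℂ)‖ ≤ 1 := ⟨hV.2, by rw [inv_inv]; exact hV.1⟩
  have hR := hs_R_le hVi (Λ ((shiftY i μ).symm z))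
  have hd2 : (h z - h ((shiftY i μ).symm z)) ^ 2 ≤ κ ^ 2 := by
    have h1 := hhκ μ ((shiftY i μ).symm z)
    rw [Equiv.apply_symm_apply] at h1
    rw [← sq_abs]; exact pow_le_pow_left₀ (abs_nonneg _) h1 2
  exact mul_le_mul hd2 hR (hs_nonneg _) (sq_nonneg _)

/-- summed: `‖h·∇*_{U,μ}λ − ∇*_{U,μ}(hλ)‖²₁ ≤ κ²·‖λ‖²₁`. [cite: Balaban1984PropagatorsII, p.247; Balaban1985BackgroundPropagators, (3.89) p.409] -/
theorem trIP_cutMulY_cdsS_sub_le (hG : G ≤ B7Prop2Explicit.unitaryUnits (Matrix (Fin N) (Fin N) ℂ)) {U : CfgY (Matrix (Fin N) (Fin N) ℂ) i}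
    (hU : ∀ μ x, U μ x ∈ G) (μ : Fin (d + 1)) {h : SiteY i → ℝ} {κ : ℝ} (hhκ : ∀ μ z, |h (shiftY i μ z) - h z| ≤ κ)
    (Λ : SiteY i → Matrix (Fin N) (Fin N) ℂ) :
    trIP (fun _ => (1 : ℝ)) (fun z => cutMulY h (cdsS i U μ Λ) z - cdsS i U μ (cutMulY h Λ) z)
        (fun z => cutMulY h (cdsS i U μ Λ) z - cdsS i U μ (cutMulY h Λ) z) ≤ κ ^ 2 * trIP (fun _ => (1 : ℝ)) Λ Λ := by
  rw [trIP_one_self_eq, trIP_one_self_eq, Finset.mul_sum]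
  calc ∑ z, ∑ a, ∑ b, ‖(cutMulY h (cdsS i U μ Λ) z - cdsS i U μ (cutMulY h Λ) z) a b‖ ^ 2
      ≤ ∑ z, κ ^ 2 * ∑ a, ∑ b, ‖Λ ((shiftY i μ).symm z) a b‖ ^ 2 := Finset.sum_le_sum fun z _ => hs_cutMulY_cdsS_sub_le i hG hU μ hhκ Λ z
    _ = ∑ z, κ ^ 2 * ∑ a, ∑ b, ‖Λ z a b‖ ^ 2 := Equiv.sum_comp (shiftY i μ).symm (fun z => κ ^ 2 * ∑ a, ∑ b, ‖Λ z a b‖ ^ 2)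

/-- a real cut-off with `|h| ≤ 1` is an `L²` contraction: `‖hλ‖²₁ ≤ ‖λ‖²₁`. [cite: Balaban1985BackgroundPropagators, (3.87) p.409 (Σh_□² = 1), bookkeeping] -/
theorem trIP_cutMulY_self_le {h : SiteY i → ℝ} (hh1 : ∀ z, |h z| ≤ 1) (Λ : SiteY i → Matrix (Fin N) (Fin N) ℂ) :
    trIP (fun _ => (1 : ℝ)) (cutMulY h Λ) (cutMulY h Λ) ≤ trIP (fun _ => (1 : ℝ)) Λ Λ := by
  rw [trIP_one_self_eq, trIP_one_self_eq]
  refine Finset.sum_le_sum fun z _ => ?_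
  have e : cutMulY (𝔸 := Matrix (Fin N) (Fin N) ℂ) h Λ z = ((h z : ℝ) : ℂ) • Λ z := cutMulY_apply h Λ z
  rw [e, hs_real_smul]
  have hh2 : h z ^ 2 ≤ 1 := by have := hh1 z; rw [← sq_abs]; nlinarith [abs_nonneg (h z)]
  have hB := hs_nonneg (Λ z)
  nlinarith

/-! ## §C2 (3.46c) for `G′_□(U)` in the FORWARD weight orientation (weight `= 1` on the source set) -/

/-- ★ **(3.46c) FOR `G′_□(U)`, FORWARD ORIENTATION**: on the class, weight `ω = 1` on `B ⊇ supp ∇*_{U,μ}λ′`, `ω ≥ W` on `A`, levels `≤ j_A` on `A`: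
`Σ_{z∈A} HS((G′_□(U)∇*_{U,μ}λ′)(z)) ≤ 16·((L^{j_A})²∕W²)·‖λ′‖²₁` (Agmon's first reading + the energy bound `⟨G′_□∇*λ′, ∇*λ′⟩ ≤ ‖λ′‖²`; §G2 is the same
member with the weight `= 1` on the output set instead). [cite: Balaban1985BackgroundPropagators, Cor 3.6 p.408, Thm 3.1 (3.46) p.398, (3.79) p.406; Agmon1982, Ch.1, Thm 1.5] -/
theorem hs_restrict_GsqY_cdsS_le_fwd [Nonempty (Fin N)] (hG : G ≤ B7Prop2Explicit.unitaryUnits (Matrix (Fin N) (Fin N) ℂ))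
    {U : CfgY (Matrix (Fin N) (Fin N) ℂ) i} {c α₀ : ℝ} (hC0 : 0 ≤ c * (kGeo i).M * α₀) (hC1 : c * (kGeo i).M * α₀ * ((d : ℝ) + 1) ≤ 1 / 16)
    (hreg : (bg9K (Matrix (Fin N) (Fin N) ℂ) G i).Reg335 c α₀ U) (D : Finset (SiteY i)) {ω : SiteY i → ℝ} (hω : ∀ z, 0 < ω z) {θb θs : ℝ}
    (hb1 : ∀ μ z, ω (shiftY i μ z) / ω z + ω z / ω (shiftY i μ z) - 2 ≤ θb * (((((ℓ + 1) ^ (blkOf i.D.toDomains z).1.1 : ℕ) : ℝ)) ^ 2)⁻¹)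
    (hb2 : ∀ μ z, ω (shiftY i μ z) / ω z + ω z / ω (shiftY i μ z) - 2 ≤ θb * (((((ℓ + 1) ^ (blkOf i.D.toDomains (shiftY i μ z)).1.1 : ℕ) : ℝ)) ^ 2)⁻¹)
    (hs : ∀ z w : SiteY i, blkOf i.D.toDomains w = blkOf i.D.toDomains z → ω z / ω w + ω w / ω z - 2 ≤ θs)
    (hκ : ((d : ℝ) + 1) * θb + θs / 2 ≤ 1 / 16) (μ : Fin (d + 1))
    {A B : Finset (SiteY i)} {Λ : SiteY i → Matrix (Fin N) (Fin N) ℂ} (hv : ∀ z, z ∉ B → cdsS i U μ Λ z = 0) (hωB : ∀ z ∈ B, ω z = 1)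
    {jA : ℕ} (hjA : ∀ z ∈ A, (blkOf i.D.toDomains z).1.1 ≤ jA) {W : ℝ} (hW0 : 0 < W) (hW : ∀ z ∈ A, W ≤ ω z) :
    ∑ z ∈ A, ∑ a, ∑ b, ‖GsqY i (parSymY i) D U (cdsS i U μ Λ) z a b‖ ^ 2
      ≤ 16 * (((((ℓ + 1) ^ jA : ℕ) : ℝ)) ^ 2 / W ^ 2) * trIP (fun _ => (1 : ℝ)) Λ Λ := by
  have hU : ∀ μ x, U μ x ∈ G := hreg.1
  have hc₀ : 1 / 16 ≤ 1 / 8 - (((d : ℝ) + 1) * θb + θs / 2) := by linarith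
  have hiX := levelMass_wsmul_GsqY_le_pairing i hG hC0 hC1 hreg D hω hb1 hb2 hs hv hωB
  have hXQ := trIP_GsqY_cdsS_cdsS_le i hG hU D μ Λ
  have hMA := sum_filter_hs_le_levelMass i ω hjA hW0.le hW (GsqY i (parSymY i) D U (cdsS i U μ Λ))
  have hQ0 : 0 ≤ trIP (fun _ => (1 : ℝ)) Λ Λ := trIP_self_nonneg _ (fun _ => one_pos) Λ
  set M := ∑ z : SiteY i, (((((ℓ + 1) ^ (blkOf i.D.toDomains z).1.1 : ℕ) : ℝ)) ^ 2)⁻¹ *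
      ∑ a, ∑ b, ‖(((ω z : ℝ) : ℂ) • GsqY i (parSymY i) D U (cdsS i U μ Λ) z) a b‖ ^ 2 with hM
  set P := ∑ z ∈ A, ∑ a, ∑ b, ‖GsqY i (parSymY i) D U (cdsS i U μ Λ) z a b‖ ^ 2 with hP
  have hLA : (0 : ℝ) < ((((ℓ + 1) ^ jA : ℕ) : ℝ)) ^ 2 := by positivity
  -- `(1∕16)·(L_A²)⁻¹·W²·P ≤ c₀ M ≤ X ≤ ‖λ‖²`
  have h1 : (1 / 16 : ℝ) * ((((((ℓ + 1) ^ jA : ℕ) : ℝ)) ^ 2)⁻¹ * W ^ 2 * P) ≤ trIP (fun _ => (1 : ℝ)) Λ Λ := by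
    have hM0 : 0 ≤ M := Finset.sum_nonneg fun z _ => mul_nonneg (inv_nonneg.2 (by positivity)) (hs_nonneg _)
    calc (1 / 16 : ℝ) * ((((((ℓ + 1) ^ jA : ℕ) : ℝ)) ^ 2)⁻¹ * W ^ 2 * P)
        ≤ (1 / 8 - (((d : ℝ) + 1) * θb + θs / 2)) * M := mul_le_mul hc₀ hMA (by positivity) (by linarith)
      _ ≤ _ := hiX.trans hXQ
  have e : P = 16 * (((((ℓ + 1) ^ jA : ℕ) : ℝ)) ^ 2 / W ^ 2) * ((1 / 16 : ℝ) * ((((((ℓ + 1) ^ jA : ℕ) : ℝ)) ^ 2)⁻¹ * W ^ 2 * P)) := by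
    field_simp
  rw [e]
  exact mul_le_mul_of_nonneg_left h1 (by positivity)

/-! ## §C3 The `h_□`-sandwiched mixed member `∇_ν M_h G′_□(U) M_h ∇*_μ` -/

/-- ★★ **THE FIELD `Φ = G′_□(U) M_h ∇\*_{U,μ} λ` ON `A`**: `Σ_{z∈A} HS(Φ z) ≤ 2·(16 + 256κ²(L^{j_B})²)·(L^{j_A})²∕W² · ‖λ‖²₁` (the forward (3.46c) on
`G′_□∇\*(M_hλ)` and (3.46a) on `G′_□ r`, `M_h∇\*λ = ∇\*(M_hλ) + r`). Hypotheses as `hs_restrict_cdS_cutMulY_GsqY_cutMulY_cdsS_le`.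
[cite: Balaban1985BackgroundPropagators, Cor 3.6 p.408, (3.46) p.398, (3.87)–(3.89) p.409; Balaban1984PropagatorsII, (2.39)–(2.44) pp.229–230] -/
theorem hs_restrict_GsqY_cutMulY_cdsS_le [Nonempty (Fin N)] (hG : G ≤ B7Prop2Explicit.unitaryUnits (Matrix (Fin N) (Fin N) ℂ))
    {U : CfgY (Matrix (Fin N) (Fin N) ℂ) i} {c α₀ : ℝ} (hC0 : 0 ≤ c * (kGeo i).M * α₀) (hC1 : c * (kGeo i).M * α₀ * ((d : ℝ) + 1) ≤ 1 / 16)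
    (hreg : (bg9K (Matrix (Fin N) (Fin N) ℂ) G i).Reg335 c α₀ U) (D : Finset (SiteY i)) {ω : SiteY i → ℝ} (hω : ∀ z, 0 < ω z) {θb θs : ℝ}
    (hb1 : ∀ μ z, ω (shiftY i μ z) / ω z + ω z / ω (shiftY i μ z) - 2 ≤ θb * (((((ℓ + 1) ^ (blkOf i.D.toDomains z).1.1 : ℕ) : ℝ)) ^ 2)⁻¹)
    (hb2 : ∀ μ z, ω (shiftY i μ z) / ω z + ω z / ω (shiftY i μ z) - 2 ≤ θb * (((((ℓ + 1) ^ (blkOf i.D.toDomains (shiftY i μ z)).1.1 : ℕ) : ℝ)) ^ 2)⁻¹)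
    (hs : ∀ z w : SiteY i, blkOf i.D.toDomains w = blkOf i.D.toDomains z → ω z / ω w + ω w / ω z - 2 ≤ θs)
    (hκ : ((d : ℝ) + 1) * θb + θs / 2 ≤ 1 / 16)
    {h : SiteY i → ℝ} {κ : ℝ} (hh1 : ∀ z, |h z| ≤ 1) (hhκ : ∀ μ z, |h (shiftY i μ z) - h z| ≤ κ) (μ : Fin (d + 1))
    {A B : Finset (SiteY i)} {Λ : SiteY i → Matrix (Fin N) (Fin N) ℂ} (hΛ : ∀ z, z ∉ B → Λ z = 0)
    (hΛ' : ∀ z, z ∉ B → Λ ((shiftY i μ).symm z) = 0) (hωB : ∀ z ∈ B, ω z = 1)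
    {jA jB : ℕ} (hjA : ∀ z ∈ A, (blkOf i.D.toDomains z).1.1 ≤ jA) (hjB : ∀ z ∈ B, (blkOf i.D.toDomains z).1.1 ≤ jB)
    {W : ℝ} (hW0 : 0 < W) (hW : ∀ z ∈ A, W ≤ ω z) :
    ∑ z ∈ A, ∑ a, ∑ b, ‖GsqY i (parSymY i) D U (cutMulY h (cdsS i U μ Λ)) z a b‖ ^ 2
      ≤ 2 * ((16 + 256 * κ ^ 2 * ((((ℓ + 1) ^ jB : ℕ) : ℝ)) ^ 2) * ((((ℓ + 1) ^ jA : ℕ) : ℝ)) ^ 2) / W ^ 2 * trIP (fun _ => (1 : ℝ)) Λ Λ := by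
  have hU : ∀ μ x, U μ x ∈ G := hreg.1
  set Λ' : SiteY i → Matrix (Fin N) (Fin N) ℂ := cutMulY h Λ with hΛ'def
  set r : SiteY i → Matrix (Fin N) (Fin N) ℂ := fun z => cutMulY h (cdsS i U μ Λ) z - cdsS i U μ Λ' z with hrdef
  have hsrc : cutMulY h (cdsS i U μ Λ) = cdsS i U μ Λ' + r := by
    funext z; simp only [hrdef, Pi.add_apply]; abel
  have hΛ'B : ∀ z, z ∉ B → Λ' z = 0 := fun z hz => by simp only [hΛ'def, cutMulY_apply, hΛ z hz, smul_zero]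
  have hΛ'B' : ∀ z, z ∉ B → Λ' ((shiftY i μ).symm z) = 0 := fun z hz => by simp only [hΛ'def, cutMulY_apply, hΛ' z hz, smul_zero]
  have hv' : ∀ z, z ∉ B → cdsS i U μ Λ' z = 0 := fun z hz => by
    show R (UboxY i U μ ((shiftY i μ).symm z))⁻¹ (Λ' ((shiftY i μ).symm z)) - Λ' z = 0
    rw [hΛ'B' z hz, hΛ'B z hz, R_zero, sub_zero]
  have hv : ∀ z, z ∉ B → cdsS i U μ Λ z = 0 := fun z hz => by
    show R (UboxY i U μ ((shiftY i μ).symm z))⁻¹ (Λ ((shiftY i μ).symm z)) - Λ z = 0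
    rw [hΛ' z hz, hΛ z hz, R_zero, sub_zero]
  have hrB : ∀ z, z ∉ B → r z = 0 := fun z hz => by
    simp only [hrdef, cutMulY_apply, hv z hz, hv' z hz, smul_zero, sub_zero]
  have hQ0 : 0 ≤ trIP (fun _ => (1 : ℝ)) Λ Λ := trIP_self_nonneg _ (fun _ => one_pos) Λ
  have hΛ'le : trIP (fun _ => (1 : ℝ)) Λ' Λ' ≤ trIP (fun _ => (1 : ℝ)) Λ Λ := trIP_cutMulY_self_le i hh1 Λ
  have hrle : trIP (fun _ => (1 : ℝ)) r r ≤ κ ^ 2 * trIP (fun _ => (1 : ℝ)) Λ Λ := by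
    have h0 := trIP_cutMulY_cdsS_sub_le i hG hU μ hhκ Λ
    rw [← hΛ'def] at h0
    exact h0
  have hsplit : GsqY i (parSymY i) D U (cutMulY h (cdsS i U μ Λ))
      = GsqY i (parSymY i) D U (cdsS i U μ Λ') + GsqY i (parSymY i) D U r := by rw [hsrc, map_add]
  have m2 : ∑ z ∈ A, ∑ a, ∑ b, ‖GsqY i (parSymY i) D U (cdsS i U μ Λ') z a b‖ ^ 2
      ≤ 16 * (((((ℓ + 1) ^ jA : ℕ) : ℝ)) ^ 2 / W ^ 2) * trIP (fun _ => (1 : ℝ)) Λ Λ :=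
    (hs_restrict_GsqY_cdsS_le_fwd i hG hC0 hC1 hreg D hω hb1 hb2 hs hκ μ hv' hωB hjA hW0 hW).trans
      (mul_le_mul_of_nonneg_left hΛ'le (by positivity))
  have m4 : ∑ z ∈ A, ∑ a, ∑ b, ‖GsqY i (parSymY i) D U r z a b‖ ^ 2
      ≤ 256 * (((((ℓ + 1) ^ jA : ℕ) : ℝ)) ^ 2 * ((((ℓ + 1) ^ jB : ℕ) : ℝ)) ^ 2 / W ^ 2) * (κ ^ 2 * trIP (fun _ => (1 : ℝ)) Λ Λ) :=
    (hs_restrict_GsqY_parSymY_le i hG hC0 hC1 hreg D hω hb1 hb2 hs hκ hrB hωB hjA hjB hW0 hW).trans (mul_le_mul_of_nonneg_left hrle (by positivity))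
  rw [hsplit]
  have hpt : ∀ z, ∑ a, ∑ b, ‖(GsqY i (parSymY i) D U (cdsS i U μ Λ') + GsqY i (parSymY i) D U r) z a b‖ ^ 2
      ≤ 2 * ∑ a, ∑ b, ‖GsqY i (parSymY i) D U (cdsS i U μ Λ') z a b‖ ^ 2 + 2 * ∑ a, ∑ b, ‖GsqY i (parSymY i) D U r z a b‖ ^ 2 :=
    fun z => by rw [Pi.add_apply]; exact hs_add_le _ _
  refine (Finset.sum_le_sum fun z _ => hpt z).trans ?_
  rw [Finset.sum_add_distrib, ← Finset.mul_sum, ← Finset.mul_sum]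
  have e : 2 * ((16 + 256 * κ ^ 2 * ((((ℓ + 1) ^ jB : ℕ) : ℝ)) ^ 2) * ((((ℓ + 1) ^ jA : ℕ) : ℝ)) ^ 2) / W ^ 2 * trIP (fun _ => (1 : ℝ)) Λ Λ
      = 2 * (16 * (((((ℓ + 1) ^ jA : ℕ) : ℝ)) ^ 2 / W ^ 2) * trIP (fun _ => (1 : ℝ)) Λ Λ)
        + 2 * (256 * (((((ℓ + 1) ^ jA : ℕ) : ℝ)) ^ 2 * ((((ℓ + 1) ^ jB : ℕ) : ℝ)) ^ 2 / W ^ 2) * (κ ^ 2 * trIP (fun _ => (1 : ℝ)) Λ Λ)) := by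
    ring
  rw [e]
  exact add_le_add (mul_le_mul_of_nonneg_left m2 (by norm_num)) (mul_le_mul_of_nonneg_left m4 (by norm_num))

/-- ★★ **ITS COVARIANT GRADIENT ON `A`**: `Σ_{z∈A}Σ_ν HS((∇_{U,ν}Φ)(z)) ≤ 2·(10 + 160κ²(L^{j_B})²)∕W² · ‖λ‖²₁` for `Φ = G′_□(U) M_h ∇\*_{U,μ} λ`
((3.46e) on `G′_□∇\*(M_hλ)`, (3.46b) on `G′_□ r`). Hypotheses as `hs_restrict_cdS_cutMulY_GsqY_cutMulY_cdsS_le`.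
[cite: Balaban1985BackgroundPropagators, Cor 3.6 p.408, (3.46) p.398, (3.87)–(3.89) p.409; Balaban1984PropagatorsII, (2.39)–(2.44) pp.229–230] -/
theorem hs_restrict_cdS_GsqY_cutMulY_cdsS_le [Nonempty (Fin N)] (hG : G ≤ B7Prop2Explicit.unitaryUnits (Matrix (Fin N) (Fin N) ℂ))
    {U : CfgY (Matrix (Fin N) (Fin N) ℂ) i} {c α₀ : ℝ} (hC0 : 0 ≤ c * (kGeo i).M * α₀) (hC1 : c * (kGeo i).M * α₀ * ((d : ℝ) + 1) ≤ 1 / 16)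
    (hreg : (bg9K (Matrix (Fin N) (Fin N) ℂ) G i).Reg335 c α₀ U) (D : Finset (SiteY i)) {ω : SiteY i → ℝ} (hω : ∀ z, 0 < ω z) {θb θs : ℝ}
    (hθb0 : 0 ≤ θb) (hθs0 : 0 ≤ θs)
    (hb1 : ∀ μ z, ω (shiftY i μ z) / ω z + ω z / ω (shiftY i μ z) - 2 ≤ θb * (((((ℓ + 1) ^ (blkOf i.D.toDomains z).1.1 : ℕ) : ℝ)) ^ 2)⁻¹)
    (hb2 : ∀ μ z, ω (shiftY i μ z) / ω z + ω z / ω (shiftY i μ z) - 2 ≤ θb * (((((ℓ + 1) ^ (blkOf i.D.toDomains (shiftY i μ z)).1.1 : ℕ) : ℝ)) ^ 2)⁻¹)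
    (hs : ∀ z w : SiteY i, blkOf i.D.toDomains w = blkOf i.D.toDomains z → ω z / ω w + ω w / ω z - 2 ≤ θs)
    (hκ : ((d : ℝ) + 1) * θb + θs / 2 ≤ 1 / 16)
    {h : SiteY i → ℝ} {κ : ℝ} (hh1 : ∀ z, |h z| ≤ 1) (hhκ : ∀ μ z, |h (shiftY i μ z) - h z| ≤ κ) (μ : Fin (d + 1))
    {A B : Finset (SiteY i)} {Λ : SiteY i → Matrix (Fin N) (Fin N) ℂ} (hΛ : ∀ z, z ∉ B → Λ z = 0)
    (hΛ' : ∀ z, z ∉ B → Λ ((shiftY i μ).symm z) = 0) (hωB : ∀ z ∈ B, ω z = 1)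
    {jB : ℕ} (hjB : ∀ z ∈ B, (blkOf i.D.toDomains z).1.1 ≤ jB)
    {W : ℝ} (hW0 : 0 < W) (hW : ∀ z ∈ A, W ≤ ω z) :
    ∑ z ∈ A, ∑ ν : Fin (d + 1), ∑ a, ∑ b, ‖cdS i U ν (GsqY i (parSymY i) D U (cutMulY h (cdsS i U μ Λ))) z a b‖ ^ 2
      ≤ 2 * (10 + 160 * κ ^ 2 * ((((ℓ + 1) ^ jB : ℕ) : ℝ)) ^ 2) / W ^ 2 * trIP (fun _ => (1 : ℝ)) Λ Λ := by
  have hU : ∀ μ x, U μ x ∈ G := hreg.1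
  set Λ' : SiteY i → Matrix (Fin N) (Fin N) ℂ := cutMulY h Λ with hΛ'def
  set r : SiteY i → Matrix (Fin N) (Fin N) ℂ := fun z => cutMulY h (cdsS i U μ Λ) z - cdsS i U μ Λ' z with hrdef
  have hsrc : cutMulY h (cdsS i U μ Λ) = cdsS i U μ Λ' + r := by
    funext z; simp only [hrdef, Pi.add_apply]; abel
  have hΛ'B : ∀ z, z ∉ B → Λ' z = 0 := fun z hz => by simp only [hΛ'def, cutMulY_apply, hΛ z hz, smul_zero]
  have hΛ'B' : ∀ z, z ∉ B → Λ' ((shiftY i μ).symm z) = 0 := fun z hz => by simp only [hΛ'def, cutMulY_apply, hΛ' z hz, smul_zero]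
  have hv' : ∀ z, z ∉ B → cdsS i U μ Λ' z = 0 := fun z hz => by
    show R (UboxY i U μ ((shiftY i μ).symm z))⁻¹ (Λ' ((shiftY i μ).symm z)) - Λ' z = 0
    rw [hΛ'B' z hz, hΛ'B z hz, R_zero, sub_zero]
  have hv : ∀ z, z ∉ B → cdsS i U μ Λ z = 0 := fun z hz => by
    show R (UboxY i U μ ((shiftY i μ).symm z))⁻¹ (Λ ((shiftY i μ).symm z)) - Λ z = 0
    rw [hΛ' z hz, hΛ z hz, R_zero, sub_zero]
  have hrB : ∀ z, z ∉ B → r z = 0 := fun z hz => by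
    simp only [hrdef, cutMulY_apply, hv z hz, hv' z hz, smul_zero, sub_zero]
  have hQ0 : 0 ≤ trIP (fun _ => (1 : ℝ)) Λ Λ := trIP_self_nonneg _ (fun _ => one_pos) Λ
  have hΛ'le : trIP (fun _ => (1 : ℝ)) Λ' Λ' ≤ trIP (fun _ => (1 : ℝ)) Λ Λ := trIP_cutMulY_self_le i hh1 Λ
  have hrle : trIP (fun _ => (1 : ℝ)) r r ≤ κ ^ 2 * trIP (fun _ => (1 : ℝ)) Λ Λ := by
    have h0 := trIP_cutMulY_cdsS_sub_le i hG hU μ hhκ Λ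
    rw [← hΛ'def] at h0
    exact h0
  have hsplit : GsqY i (parSymY i) D U (cutMulY h (cdsS i U μ Λ))
      = GsqY i (parSymY i) D U (cdsS i U μ Λ') + GsqY i (parSymY i) D U r := by rw [hsrc, map_add]
  have hW2 : (0 : ℝ) < W ^ 2 := by positivity
  have m1 : ∑ z ∈ A, ∑ ν : Fin (d + 1), ∑ a, ∑ b, ‖cdS i U ν (GsqY i (parSymY i) D U (cdsS i U μ Λ')) z a b‖ ^ 2
      ≤ 10 * trIP (fun _ => (1 : ℝ)) Λ Λ / W ^ 2 :=
    (hs_restrict_cdS_GsqY_cdsS_le i hG hC0 hC1 hreg D hω hθb0 hθs0 hb1 hb2 hs hκ μ hv' hωB hW0 hW).trans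
      (div_le_div_of_nonneg_right (by linarith) hW2.le)
  have m3 : ∑ z ∈ A, ∑ ν : Fin (d + 1), ∑ a, ∑ b, ‖cdS i U ν (GsqY i (parSymY i) D U r) z a b‖ ^ 2
      ≤ 160 * (((((ℓ + 1) ^ jB : ℕ) : ℝ)) ^ 2 / W ^ 2) * (κ ^ 2 * trIP (fun _ => (1 : ℝ)) Λ Λ) :=
    (hs_restrict_cdS_GsqY_parSymY_le i hG hC0 hC1 hreg D hω hθb0 hθs0 hb1 hb2 hs hκ hrB hωB hjB hW0 hW).trans
      (mul_le_mul_of_nonneg_left hrle (by positivity))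
  rw [hsplit]
  have hpt : ∀ z ν, ∑ a, ∑ b, ‖cdS i U ν (GsqY i (parSymY i) D U (cdsS i U μ Λ') + GsqY i (parSymY i) D U r) z a b‖ ^ 2
      ≤ 2 * ∑ a, ∑ b, ‖cdS i U ν (GsqY i (parSymY i) D U (cdsS i U μ Λ')) z a b‖ ^ 2
        + 2 * ∑ a, ∑ b, ‖cdS i U ν (GsqY i (parSymY i) D U r) z a b‖ ^ 2 := fun z ν => by
    rw [show cdS i U ν (GsqY i (parSymY i) D U (cdsS i U μ Λ') + GsqY i (parSymY i) D U r) z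
        = cdS i U ν (GsqY i (parSymY i) D U (cdsS i U μ Λ')) z + cdS i U ν (GsqY i (parSymY i) D U r) z
        from B9Eq39Adjoint.covD_add _ _ ν _ _ z]
    exact hs_add_le _ _
  refine (Finset.sum_le_sum fun z _ => Finset.sum_le_sum fun ν _ => hpt z ν).trans ?_
  simp only [Finset.sum_add_distrib, ← Finset.mul_sum]
  have e : 2 * (10 + 160 * κ ^ 2 * ((((ℓ + 1) ^ jB : ℕ) : ℝ)) ^ 2) / W ^ 2 * trIP (fun _ => (1 : ℝ)) Λ Λ
      = 2 * (10 * trIP (fun _ => (1 : ℝ)) Λ Λ / W ^ 2)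
        + 2 * (160 * (((((ℓ + 1) ^ jB : ℕ) : ℝ)) ^ 2 / W ^ 2) * (κ ^ 2 * trIP (fun _ => (1 : ℝ)) Λ Λ)) := by
    field_simp
  rw [e]
  exact add_le_add (mul_le_mul_of_nonneg_left m1 (by norm_num)) (mul_le_mul_of_nonneg_left m3 (by norm_num))

/-- ★★★ **THE CUT-OFF–SANDWICHED MIXED MEMBER OF COROLLARY 3.6 IN `L²`, UNIFORMLY IN □** — the shape of row 18's `L2MixedLegs37.lm` at the genuine letters.
On the class `(bg9K (M_N ℂ) G i).Reg335 c α₀` (`N ≥ 1`, `0 ≤ c·M·α₀`, `c·M·α₀·(d+1) ≤ 1∕16`), for any site set `D` (□̃), a real cut-off `h` with `|h| ≤ 1` and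
one-step oscillation `|h(z+e_μ) − h(z)| ≤ κ` (print's `|∂h_□| ≤ O(1)(MLʲη)⁻¹`), a weight `ω` as in files 6∕8 (`ω = 1` on `B`, `ω ≥ W > 0` on `A`, bond ratios
`≤ θ_b(L^{lev})⁻²`, block oscillation `≤ θ_s`, `0 ≤ θ_b, θ_s`, `(d+1)θ_b + θ_s∕2 ≤ 1∕16`), levels `≤ j_A` on `A`, `≤ j_B` on `B`, and `λ` with `λ` AND its
`e_μ`-translate vanishing off `B`:
`Σ_{z∈A} HS((∇_{U,ν} M_h G′_□(U) M_h ∇*_{U,μ} λ)(z)) ≤ 4·(10 + κ²(16(L^{j_A})² + 160(L^{j_B})²) + 256κ⁴(L^{j_A})²(L^{j_B})²)∕W² · ‖λ‖²₁`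
— `O(1)∕W²` once `κ·L^{j} = O(M⁻¹)` (the cube's partition function at the cube's levels).  Assembly: `M_h∇*λ = ∇*(M_hλ) + r` (`‖r‖ ≤ κ‖λ‖`), Leibniz through `∇_ν`,
then (3.46e)∕(3.46c-fwd) on `G′_□∇*(M_hλ)` and (3.46b)∕(3.46a) on `G′_□ r`. [cite: Balaban1985BackgroundPropagators, Cor 3.6 p.408, (3.46) p.398, (3.87)–(3.89) p.409; Balaban1984PropagatorsII, (2.39)–(2.44) pp.229–230, p.247; Agmon1982, Ch.1, Thm 1.5] -/
theorem hs_restrict_cdS_cutMulY_GsqY_cutMulY_cdsS_le [Nonempty (Fin N)] (hG : G ≤ B7Prop2Explicit.unitaryUnits (Matrix (Fin N) (Fin N) ℂ))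
    {U : CfgY (Matrix (Fin N) (Fin N) ℂ) i} {c α₀ : ℝ} (hC0 : 0 ≤ c * (kGeo i).M * α₀) (hC1 : c * (kGeo i).M * α₀ * ((d : ℝ) + 1) ≤ 1 / 16)
    (hreg : (bg9K (Matrix (Fin N) (Fin N) ℂ) G i).Reg335 c α₀ U) (D : Finset (SiteY i)) {ω : SiteY i → ℝ} (hω : ∀ z, 0 < ω z) {θb θs : ℝ}
    (hθb0 : 0 ≤ θb) (hθs0 : 0 ≤ θs)
    (hb1 : ∀ μ z, ω (shiftY i μ z) / ω z + ω z / ω (shiftY i μ z) - 2 ≤ θb * (((((ℓ + 1) ^ (blkOf i.D.toDomains z).1.1 : ℕ) : ℝ)) ^ 2)⁻¹)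
    (hb2 : ∀ μ z, ω (shiftY i μ z) / ω z + ω z / ω (shiftY i μ z) - 2 ≤ θb * (((((ℓ + 1) ^ (blkOf i.D.toDomains (shiftY i μ z)).1.1 : ℕ) : ℝ)) ^ 2)⁻¹)
    (hs : ∀ z w : SiteY i, blkOf i.D.toDomains w = blkOf i.D.toDomains z → ω z / ω w + ω w / ω z - 2 ≤ θs)
    (hκ : ((d : ℝ) + 1) * θb + θs / 2 ≤ 1 / 16)
    {h : SiteY i → ℝ} {κ : ℝ} (hh1 : ∀ z, |h z| ≤ 1) (hhκ : ∀ μ z, |h (shiftY i μ z) - h z| ≤ κ) (ν μ : Fin (d + 1))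
    {A B : Finset (SiteY i)} {Λ : SiteY i → Matrix (Fin N) (Fin N) ℂ} (hΛ : ∀ z, z ∉ B → Λ z = 0)
    (hΛ' : ∀ z, z ∉ B → Λ ((shiftY i μ).symm z) = 0) (hωB : ∀ z ∈ B, ω z = 1)
    {jA jB : ℕ} (hjA : ∀ z ∈ A, (blkOf i.D.toDomains z).1.1 ≤ jA) (hjB : ∀ z ∈ B, (blkOf i.D.toDomains z).1.1 ≤ jB)
    {W : ℝ} (hW0 : 0 < W) (hW : ∀ z ∈ A, W ≤ ω z) :
    ∑ z ∈ A, ∑ a, ∑ b, ‖cdS i U ν (cutMulY h (GsqY i (parSymY i) D U (cutMulY h (cdsS i U μ Λ)))) z a b‖ ^ 2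
      ≤ 4 * (10 + κ ^ 2 * (16 * ((((ℓ + 1) ^ jA : ℕ) : ℝ)) ^ 2 + 160 * ((((ℓ + 1) ^ jB : ℕ) : ℝ)) ^ 2)
          + 256 * κ ^ 4 * (((((ℓ + 1) ^ jA : ℕ) : ℝ)) ^ 2 * ((((ℓ + 1) ^ jB : ℕ) : ℝ)) ^ 2)) / W ^ 2 * trIP (fun _ => (1 : ℝ)) Λ Λ := by
  have hκ0 : 0 ≤ κ := le_trans (abs_nonneg _) (hhκ μ (Classical.arbitrary _))
  have mΦ := hs_restrict_GsqY_cutMulY_cdsS_le i hG hC0 hC1 hreg D hω hb1 hb2 hs hκ hh1 hhκ μ hΛ hΛ' hωB hjA hjB hW0 hW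
  have mD := hs_restrict_cdS_GsqY_cutMulY_cdsS_le i hG hC0 hC1 hreg D hω hθb0 hθs0 hb1 hb2 hs hκ hh1 hhκ μ hΛ hΛ' hωB hjB hW0 hW
  set Φ := GsqY i (parSymY i) D U (cutMulY h (cdsS i U μ Λ)) with hΦ
  -- Leibniz through `∇_ν`, pointwise, then summed over `A`
  have hpt : ∀ z, ∑ a, ∑ b, ‖cdS i U ν (cutMulY h Φ) z a b‖ ^ 2
      ≤ 2 * ∑ ν' : Fin (d + 1), ∑ a, ∑ b, ‖cdS i U ν' Φ z a b‖ ^ 2 + 2 * κ ^ 2 * ∑ a, ∑ b, ‖Φ z a b‖ ^ 2 := by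
    intro z
    refine (hs_cdS_cutMulY_le i U ν hh1 hhκ Φ z).trans (add_le_add (mul_le_mul_of_nonneg_left ?_ (by norm_num)) le_rfl)
    exact Finset.single_le_sum (f := fun ν' : Fin (d + 1) => ∑ a, ∑ b, ‖cdS i U ν' Φ z a b‖ ^ 2) (fun _ _ => hs_nonneg _) (Finset.mem_univ ν)
  refine (Finset.sum_le_sum fun z _ => hpt z).trans ?_
  rw [Finset.sum_add_distrib, ← Finset.mul_sum, ← Finset.mul_sum]
  have e : 4 * (10 + κ ^ 2 * (16 * ((((ℓ + 1) ^ jA : ℕ) : ℝ)) ^ 2 + 160 * ((((ℓ + 1) ^ jB : ℕ) : ℝ)) ^ 2)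
          + 256 * κ ^ 4 * (((((ℓ + 1) ^ jA : ℕ) : ℝ)) ^ 2 * ((((ℓ + 1) ^ jB : ℕ) : ℝ)) ^ 2)) / W ^ 2 * trIP (fun _ => (1 : ℝ)) Λ Λ
      = 2 * (2 * (10 + 160 * κ ^ 2 * ((((ℓ + 1) ^ jB : ℕ) : ℝ)) ^ 2) / W ^ 2 * trIP (fun _ => (1 : ℝ)) Λ Λ)
        + 2 * κ ^ 2 * (2 * ((16 + 256 * κ ^ 2 * ((((ℓ + 1) ^ jB : ℕ) : ℝ)) ^ 2) * ((((ℓ + 1) ^ jA : ℕ) : ℝ)) ^ 2) / W ^ 2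
          * trIP (fun _ => (1 : ℝ)) Λ Λ) := by
    field_simp
    ring
  rw [e]
  exact add_le_add (mul_le_mul_of_nonneg_left mD (by norm_num)) (mul_le_mul_of_nonneg_left mΦ (by positivity))

end CutoffMixed

end Literature.MathematicalPhysics.QuantumFieldTheory.Balaban1983to89.B9Thm31SiteGsqCutoffMixedReg335Y
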